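import Summits.HodgeConjecture.HodgeConjecture.Theorems.HeckePrymWeilSummitOffWeilSectorCupProductAlgebraicDivisor
import Summits.HodgeConjecture.HodgeConjecture.Theorems.PadicSemiregularLiftHodgeBeyondAnchorsDiagonalPullback
import Literature.AlgebraicGeometry.HodgeTheory.SupportedHodgeClassesAlgebraic
import Literature.AlgebraicGeometry.HodgeTheory.GysinKernelProofs
import Literature.AlgebraicGeometry.HodgeTheory.GlobalInvariantCyclesProofs
import Literature.AlgebraicGeometry.HodgeTheory.ChernCharacterBetti
import Literature.AlgebraicTopology.SingularHomology.UniversalCoefficientsField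
import HarnessLib

/-!
# Crux `PullbackAlgebraic` (stmt-HodgeConjecture-1071): the Leray–Hirsch READ-OUT of algebraic
# classes along a fibration, and the pull-back along a section (the coniveau algebra of
# `stub_sectionPullback`, both registered skeletons `Lines/normal_cone.lean`, `Lines/birth.lean`)

Work item stmt-HodgeConjecture-1071 (`BoundaryReadout.PullbackAlgebraic` = `QbarEnvelope.PullbackAlgebraic`).
The registered stub `stub_sectionPullback` of the active skeleton `Cruxes/PullbackAlgebraic/Lines/normal_cone.lean`
asks: for `q : E → X` smooth projective, Zariski-locally over `X` a product `U × ℙʳ`, and a section `s`,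
`s^*(Nᵖ H²ᵖ(E)) ⊆ Nᵖ H²ᵖ(X)`. Its printed proof (W. Fulton, *Intersection Theory*, Thm. 3.3 (b) and §3.3;
C. Voisin, *Hodge Theory I*, Lemma 7.32) is the projective bundle formula: every `y ∈ H²ᵖ(E)` is
`Σ_{b} q^* x_b ∪ ζᵇ` for a divisor class `ζ`, and the coefficients `x_b` are extracted by the Gysin
push-forward `q_*` from the top power down. This file proves that COHOMOLOGICAL half on the tree's
carriers, isolating the three geometric inputs as hypotheses:

* (span)  some expansion `y = Σ_{b < B} q^* x_b ∪ ζᵇ` (`B ≤ p + 1`, `B ≤ r + 1`) — Leray–Hirsch;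
* (coniv) `q^*` carries `algebraicClasses X c` into `algebraicClasses E c` — e.g. `q` flat
  (`map_mem_algebraicClasses_of_flat`);
* (λ)     `q_* (ζʳ) ≠ 0` in `H⁰(X(ℂ); ℂ) = ℂ · 1` — the fibre degree of `ζ`.

PROVED here (no `sorry`, no named fact):

* `cupProduct_cupPowTwo_mem_algebraicClasses` — `Nᶜ H²ᶜ ∪ ζʲ ⊆ Nᶜ⁺ʲ` for `ζ ∈ N¹ H²` (iterating the
  landed divisor case `stub_cupProductAlgebraicDivisor`);
* `eq_zero_of_forall_cupProduct_eq_zero` — the cup product pairing of a smooth projective variety is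
  non-degenerate (Poincaré duality `OrientationFamily.hasPoincareDuality` + universal coefficients);
* `complexGysin_cupProduct_map_eq_zero_of_lt` — `q_*(q^* x ∪ z) = 0` whenever `deg z < 2r`
  (`r` = relative dimension): the degree vanishing of the extraction, proved through the pairing
  (the projection formula `q_*(q^* v ∪ (q^* x ∪ z)) = v ∪ q_*(…)` and `v ∪ x = 0` above the top degree);
* `lerayHirschCoeff_mem_algebraicClasses` — **the coefficients of an algebraic class are algebraic**:
  if `Σ_b q^* x_b ∪ ζᵇ ∈ Nᵖ H²ᵖ(E)` then `x_b ∈ Nᵖ⁻ᵇ H²ᵖ⁻²ᵇ(X)` for every `b` (top-down extraction;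
  the correction terms are `x_b ∪ q_*(ζ^{r+b-a}) = q_*(q^* x_b ∪ ζ^{r+b-a})`, algebraic by (coniv),
  divisor cups and the coniveau shift of Gysin maps `complexGysin_mem_supportedClasses`);
* `map_section_mem_algebraicClasses_of_lerayHirschSpan` — **the section read-out**:
  `s^* y = Σ_b x_b ∪ (s^* ζ)ᵇ ∈ Nᵖ` (`s^* ζ ∈ N¹` by `map_mem_algebraicClasses_one`);
* `sectionPullback_of_lerayHirschSpan` — the same in the binder shape of `stub_sectionPullback`, with
  the Zariski-local triviality clause replaced by (span) ∧ (coniv) ∧ (λ).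

So the registered stub reduces to: Zariski-local triviality ⟹ (span) (Leray–Hirsch over the
trivialising cover), (coniv) (flatness) and (λ) (through the section: `q_* s_* = id`).

## References

* [Fulton1998] W. Fulton, Intersection Theory, 2nd ed. (1998), Thm. 3.3 (b), §3.3, Ex. 19.2.1.
* [VoisinHodgeI2002] C. Voisin, Hodge Theory and Complex Algebraic Geometry I (2002), Lemma 7.32, §7.3.3.
* [FultonYoungTableaux1997] W. Fulton, Young Tableaux (1997), App. B §B.1 (3), (5), (6).
* [HatcherAT2002] A. Hatcher, Algebraic Topology (2002), §3.2 Prop. 3.10, §3.3 Thm. 3.30, p. 241.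
-/

noncomputable section

-- every declaration of this problem lives in `Summit.HodgeConjecture.HodgeConjecture.…` (summit = sub-problem)
set_option linter.dupNamespace false

open CategoryTheory AlgebraicGeometry
open Literature.AlgebraicTopology.SingularHomology
open Literature.AlgebraicGeometry.Motives Literature.AlgebraicGeometry.HodgeTheory

namespace Summit.HodgeConjecture.HodgeConjecture.Theorems

/-! ### Cup powers of a divisor class -/

/-- `xⁱ ∪ xʲ = xⁱ⁺ʲ` for the cup powers `cupPowTwo` of a degree-`2` class.
[cite: HatcherAT2002, §3.2 p. 211] -/
theorem cupProduct_cupPowTwo_cupPowTwo {Y : Type} [TopologicalSpace Y]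
    (x : singularCohomology ℂ ℂ Y 2) (i j : ℕ) (h : 2 * i + 2 * j = 2 * (i + j)) :
    cupProduct h (cupPowTwo x i) (cupPowTwo x j) = cupPowTwo x (i + j) := by
  induction j with
  | zero => exact cupProduct_one' ℂ _ _
  | succ j ih =>
    rw [cupPowTwo_succ, ← cupProduct_assoc (show 2 * i + 2 * j = 2 * (i + j) by ring)
      (two_mul_add_two j) (show 2 * (i + j) + 2 = 2 * (i + (j + 1)) by ring) h, ih (by ring)]
    rfl

/-- **`Nᶜ H²ᶜ ∪ ζʲ ⊆ Nᶜ⁺ʲ H²ᶜ⁺²ʲ` for a divisor class `ζ ∈ N¹ H²`** on a smooth projective complex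
variety (iterate the divisor case of Voisin II Prop. 9.20, the tree's theorem
`stub_cupProductAlgebraicDivisor`). [cite: VoisinHodgeII2003, §9.2.4 Prop. 9.20]
[cite: Fulton1998, §2.3–2.4 and §19.2 Cor. 19.2] -/
theorem cupProduct_cupPowTwo_mem_algebraicClasses {d : ℕ} {V : SchemeOver ℂ}
    (hV : IsSmoothProjective d V) {ζ : complexBetti V 2} (hζ : ζ ∈ algebraicClasses V 1)
    {c : ℕ} {y : complexBetti V (2 * c)} (hy : y ∈ algebraicClasses V c) :
    ∀ (j : ℕ) {t : ℕ} (ht : c + j = t) (h2 : 2 * c + 2 * j = 2 * t),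
      cupProduct h2 y (cupPowTwo ζ j) ∈ algebraicClasses V t
  | 0, t, ht, h2 => by
    subst ht
    have e : cupProduct h2 y (cupPowTwo ζ 0) = y := cupProduct_one' ℂ _ _
    rw [e]
    exact hy
  | j + 1, t, ht, h2 => by
    subst ht
    have ih := cupProduct_cupPowTwo_mem_algebraicClasses hV hζ hy j rfl (by ring)
    rw [cupPowTwo_succ, ← cupProduct_assoc (show 2 * c + 2 * j = 2 * (c + j) by ring)
      (two_mul_add_two j) (two_mul_add_two_mul (c + j) 1) h2]
    exact stub_cupProductAlgebraicDivisor hV ih hζ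

/-! ### Non-degeneracy of the cup product pairing and the degree vanishing of `q_*` -/

variable {n r : ℕ} {X E : SchemeOver ℂ}

/-- **The cup product pairing of a smooth projective variety is non-degenerate**: if
`v ∪ u = 0` for every class `v` of complementary degree, then `u = 0` (`⟨u, v ⌢ [X]⟩ = ⟨v ∪ u, [X]⟩`,
Poincaré duality `v ↦ v ⌢ [X]` is onto, and the Kronecker map is one-to-one over a field).
[cite: HatcherAT2002, §3.3 Thm. 3.30 and p. 241] -/
theorem eq_zero_of_forall_cupProduct_eq_zero (μ : OrientationFamily) (hX : IsSmoothProjective n X) {b b' : ℕ}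
    (h : b' + b = 2 * n) {u : complexBetti X b}
    (hu : ∀ v : complexBetti X b', cupProduct h v u = 0) : u = 0 := by
  have hμ := OrientationFamily.hasPoincareDuality μ hX
  apply kroneckerPairing_injective_of_field ℂ (ComplexPoints X) b
  rw [map_zero]
  refine LinearMap.ext fun z ↦ ?_
  obtain ⟨v, rfl⟩ := (hμ h).2 z
  rw [LinearMap.zero_apply, poincareDualityMap_apply, ← kroneckerPairing_cupProduct, hu v, map_zero,
    LinearMap.zero_apply]

/-- **Degree vanishing of the extraction**: for `q : E ⟶ X` between smooth projective varieties of
dimensions `n + r` and `n`, `x ∈ Hᶜ(X(ℂ))` and `z ∈ H²ᵏ(E(ℂ))` with `k < r`, `q_*(q^* x ∪ z) = 0`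
(in print: `q_*(q^* x ∪ z) = x ∪ q_* z` and `q_* z` has negative degree; here: for every `v` of
complementary degree `v ∪ q_*(q^* x ∪ z) = q_*(q^*(v ∪ x) ∪ z)` by the projection formula, and
`v ∪ x` lies above the top degree of `X`). [cite: FultonYoungTableaux1997, Appendix B §B.1 (6)]
[cite: HatcherAT2002, §3.3 Thm. 3.30] -/
theorem complexGysin_cupProduct_map_eq_zero_of_lt (μ : OrientationFamily) (hX : IsSmoothProjective n X)
    (hE : IsSmoothProjective (n + r) E) (q : E ⟶ X) {c k a b : ℕ} (hk : k < r)
    (hca : c + 2 * k = a) (hab : a + 2 * n = b + 2 * (n + r)) (x : complexBetti X c)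
    (z : complexBetti E (2 * k)) :
    complexGysin μ hE hX q hab (cupProduct hca (complexBetti.map q c x) z) = 0 := by
  have hμ := OrientationFamily.hasPoincareDuality μ
  by_cases hb : 2 * n < b
  · haveI := subsingleton_complexBetti hX hb
    exact Subsingleton.elim _ _
  · refine eq_zero_of_forall_cupProduct_eq_zero μ hX (b' := 2 * n - b) (by omega) fun v ↦ ?_
    rw [← complexGysin_cup hμ hE hX q (rfl : (2 * n - b) + a = (2 * n - b) + a) (by omega) hab
      (by omega) v, ← cupProduct_assoc (rfl : (2 * n - b) + c = (2 * n - b) + c) hca (by omega)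
      rfl, ← cupProduct_map]
    haveI := subsingleton_complexBetti hX (k := 2 * n - b + c) (by omega)
    rw [Subsingleton.elim (cupProduct rfl v x) 0, map_zero, map_zero, LinearMap.zero_apply, map_zero]

/-! ### The coefficients of an algebraic class in a divisor-power expansion are algebraic -/

/-- Degree bookkeeping for the expansions `Σ_{b < B} q^* x_b ∪ ζᵇ` in degree `2p`, `B ≤ p + 1`. [folklore] -/
theorem two_mul_sub_add (p : ℕ) {B : ℕ} (hBp : B ≤ p + 1) (b : Fin B) :
    2 * (p - b) + 2 * (b : ℕ) = 2 * p := by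
  have := b.2; omega

/-- **The coefficients of an algebraic class are algebraic** (the Gysin extraction of the
projective bundle formula, run on the support carriers). Let `q : E ⟶ X` be a morphism of smooth
projective complex varieties of dimensions `n + r`, `n`; `ζ ∈ N¹ H²(E)` a divisor class with
`q_*(ζʳ) = λ · 1`, `λ ≠ 0`; and suppose `q^*` preserves algebraic classes. If
`Σ_{b < B} q^* x_b ∪ ζᵇ ∈ Nᵖ H²ᵖ(E)` (`B ≤ p + 1`, `B ≤ r + 1`), then `x_b ∈ Nᵖ⁻ᵇ H²ᵖ⁻²ᵇ(X)` for every
`b`. Proof, top down in `a`: apply `q_*(· ∪ ζ^{r-a})`; the terms `b < a` vanish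
(`complexGysin_cupProduct_map_eq_zero_of_lt`), the term `b = a` is `x_a ∪ q_*(ζʳ) = λ x_a`
(projection formula), the terms `b > a` are `q_*(q^* x_b ∪ ζ^{r+b-a})`, algebraic by induction,
divisor cups and the coniveau shift of `q_*`. [cite: Fulton1998, Thm. 3.3 (b) and §3.3]
[cite: VoisinHodgeI2002, Lemma 7.32] [cite: FultonYoungTableaux1997, Appendix B §B.1 (6)] -/
theorem lerayHirschCoeff_mem_algebraicClasses (μ : OrientationFamily) (hX : IsSmoothProjective n X)
    (hE : IsSmoothProjective (n + r) E) (q : E ⟶ X) {ζ : complexBetti E 2}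
    (hζ : ζ ∈ algebraicClasses E 1)
    (hconiv : ∀ (c : ℕ), ∀ x ∈ algebraicClasses X c, complexBetti.map q (2 * c) x ∈ algebraicClasses E c)
    {lam : ℂ} (hlam0 : lam ≠ 0)
    (hlam : complexGysin μ hE hX q (show 2 * r + 2 * n = 0 + 2 * (n + r) by ring) (cupPowTwo ζ r) =
      lam • singularCohomology.one ℂ _)
    {p B : ℕ} (hBp : B ≤ p + 1) (hBr : B ≤ r + 1) (x : (b : Fin B) → complexBetti X (2 * (p - b)))
    (hy : (∑ b : Fin B, cupProduct (two_mul_sub_add p hBp b)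
      (complexBetti.map q (2 * (p - b)) (x b)) (cupPowTwo ζ b)) ∈ algebraicClasses E p) :
    ∀ b : Fin B, x b ∈ algebraicClasses X (p - b) := by
  have hμ := OrientationFamily.hasPoincareDuality μ
  have hS := gysinMap_restrictCompl_eq_zero_of_field ℂ
  -- strong downward induction on the index
  suffices H : ∀ (e : ℕ) (a : Fin B), B ≤ a + e → x a ∈ algebraicClasses X (p - a) from
    fun b ↦ H B b (by omega)
  intro e
  induction e with
  | zero => intro a ha; exact absurd a.2 (by omega)
  | succ e ih =>
    intro a ha
    -- write `r = a + j`
    obtain ⟨j, rfl⟩ : ∃ j, r = a + j := ⟨r - a, by have := a.2; omega⟩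
    have hap : (a : ℕ) ≤ p := by have := a.2; omega
    -- the class `Y = y ∪ ζʲ ∈ N^{p+j}` and its push-forward `G = q_* Y ∈ N^{p-a}`
    set y := ∑ b : Fin B, cupProduct (two_mul_sub_add p hBp b)
      (complexBetti.map q (2 * (p - b)) (x b)) (cupPowTwo ζ b) with hy_def
    have hY : cupProduct (show 2 * p + 2 * j = 2 * (p + j) by ring) y (cupPowTwo ζ j) ∈
        algebraicClasses E (p + j) :=
      cupProduct_cupPowTwo_mem_algebraicClasses hE hζ hy j rfl (by ring)
    have habG : 2 * (p + j) + 2 * n = 2 * (p - a) + 2 * (n + (a + j)) := by omega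
    have hG : complexGysin μ hE hX q habG (cupProduct (show 2 * p + 2 * j = 2 * (p + j) by ring) y
        (cupPowTwo ζ j)) ∈ algebraicClasses X (p - a) :=
      complexGysin_mem_supportedClasses hS μ hμ hE hX q habG (r := p + j) (s := p - a) (by omega) hY
    -- the terms `T b = q_*(q^* x_b ∪ ζ^{b+j})`
    have hdeg : ∀ b : Fin B, 2 * (p - b) + 2 * ((b : ℕ) + j) = 2 * (p + j) := by
      intro b; have := b.2; omega
    set T : Fin B → complexBetti X (2 * (p - a)) := fun b ↦ complexGysin μ hE hX q habG
      (cupProduct (hdeg b) (complexBetti.map q (2 * (p - b)) (x b)) (cupPowTwo ζ (b + j))) with hT_def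
    -- `G = Σ_b T b`
    have hGT : complexGysin μ hE hX q habG (cupProduct (show 2 * p + 2 * j = 2 * (p + j) by ring) y
        (cupPowTwo ζ j)) = ∑ b : Fin B, T b := by
      rw [hy_def, map_sum, LinearMap.sum_apply, map_sum]
      refine Finset.sum_congr rfl fun b _ ↦ ?_
      rw [hT_def, cupProduct_assoc (two_mul_sub_add p hBp b) (show 2 * (b : ℕ) + 2 * j = 2 * (b + j) by ring)
        (show 2 * p + 2 * j = 2 * (p + j) by ring) (hdeg b), cupProduct_cupPowTwo_cupPowTwo]
    -- `T b = 0` for `b < a`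
    have hlt : ∀ b : Fin B, (b : ℕ) < a → T b = 0 := by
      intro b hb
      exact complexGysin_cupProduct_map_eq_zero_of_lt μ hX hE q (k := b + j) (by omega) (hdeg b) habG _ _
    -- `T a = λ • x a`
    have heq : T a = lam • x a := by
      simp only [hT_def]
      rw [complexGysin_cup hμ hE hX q (hdeg a) habG
        (show 2 * ((a : ℕ) + j) + 2 * n = 0 + 2 * (n + (a + j)) by ring) (Nat.add_zero _) (x a), hlam,
        LinearMap.map_smul, cupProduct_one' ℂ (Nat.add_zero _)]
    -- `T b ∈ N^{p-a}` for `a < b`, by the induction hypothesis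
    have hgt : ∀ b : Fin B, (a : ℕ) < b → T b ∈ algebraicClasses X (p - a) := by
      intro b hb
      have hxb : x b ∈ algebraicClasses X (p - b) := ih b (by omega)
      have h1 : complexBetti.map q (2 * (p - b)) (x b) ∈ algebraicClasses E (p - b) := hconiv _ _ hxb
      have h2 : cupProduct (hdeg b) (complexBetti.map q (2 * (p - b)) (x b)) (cupPowTwo ζ (b + j)) ∈
          algebraicClasses E (p + j) :=
        cupProduct_cupPowTwo_mem_algebraicClasses hE hζ h1 (b + j) (by have := b.2; omega) (hdeg b)
      exact complexGysin_mem_supportedClasses hS μ hμ hE hX q habG (r := p + j) (s := p - a)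
        (by omega) h2
    -- assemble: `λ • x a = G - Σ_{b ≠ a} T b`
    have hsplit : ∑ b : Fin B, T b = T a + ∑ b ∈ Finset.univ.erase a, T b :=
      (Finset.add_sum_erase _ _ (Finset.mem_univ a)).symm
    have hrest : ∑ b ∈ Finset.univ.erase a, T b ∈ algebraicClasses X (p - a) := by
      refine Submodule.sum_mem _ fun b hb ↦ ?_
      rcases lt_or_gt_of_ne (Fin.val_injective.ne (Finset.ne_of_mem_erase hb)) with h | h
      · rw [hlt b h]; exact Submodule.zero_mem _
      · exact hgt b h
    have hlamx : lam • x a ∈ algebraicClasses X (p - a) := by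
      have e : lam • x a = ∑ b : Fin B, T b - ∑ b ∈ Finset.univ.erase a, T b := by
        rw [hsplit, heq, add_sub_cancel_right]
      rw [e, ← hGT]
      exact Submodule.sub_mem _ hG hrest
    have := Submodule.smul_mem _ lam⁻¹ hlamx
    rwa [inv_smul_smul₀ hlam0] at this

/-! ### The read-out along a section -/

/-- **The section read-out.** In the situation of `lerayHirschCoeff_mem_algebraicClasses`, if
moreover `s : X ⟶ E` is a section of `q` and `y = Σ_{b < B} q^* x_b ∪ ζᵇ ∈ Nᵖ H²ᵖ(E)`, then
`s^* y = Σ_b x_b ∪ (s^* ζ)ᵇ ∈ Nᵖ H²ᵖ(X)`: the coefficients are algebraic, `s^* ζ ∈ N¹` (pull-back of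
divisor classes, `map_mem_algebraicClasses_one`), and divisor cups raise the coniveau.
[cite: Fulton1998, Thm. 3.3 (b) and Ex. 19.2.1] [cite: VoisinHodgeI2002, Lemma 7.32] -/
theorem map_section_sum_mem_algebraicClasses (μ : OrientationFamily) (hX : IsSmoothProjective n X)
    (hE : IsSmoothProjective (n + r) E) (q : E ⟶ X) (s : X ⟶ E) (hsq : s ≫ q = 𝟙 X)
    {ζ : complexBetti E 2} (hζ : ζ ∈ algebraicClasses E 1)
    (hconiv : ∀ (c : ℕ), ∀ x ∈ algebraicClasses X c, complexBetti.map q (2 * c) x ∈ algebraicClasses E c)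
    {lam : ℂ} (hlam0 : lam ≠ 0)
    (hlam : complexGysin μ hE hX q (show 2 * r + 2 * n = 0 + 2 * (n + r) by ring) (cupPowTwo ζ r) =
      lam • singularCohomology.one ℂ _)
    {p B : ℕ} (hBp : B ≤ p + 1) (hBr : B ≤ r + 1) (x : (b : Fin B) → complexBetti X (2 * (p - b)))
    (hy : (∑ b : Fin B, cupProduct (two_mul_sub_add p hBp b)
      (complexBetti.map q (2 * (p - b)) (x b)) (cupPowTwo ζ b)) ∈ algebraicClasses E p) :
    complexBetti.map s (2 * p) (∑ b : Fin B, cupProduct (two_mul_sub_add p hBp b)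
      (complexBetti.map q (2 * (p - b)) (x b)) (cupPowTwo ζ b)) ∈ algebraicClasses X p := by
  have hx := lerayHirschCoeff_mem_algebraicClasses μ hX hE q hζ hconiv hlam0 hlam hBp hBr x hy
  have hsζ : complexBetti.map s (2 * 1) ζ ∈ algebraicClasses X 1 :=
    HodgeBeyondAnchors.map_mem_algebraicClasses_one hE hX s hζ
  rw [map_sum]
  refine Submodule.sum_mem _ fun b _ ↦ ?_
  rw [cupProduct_map, map_cupPowTwo, ← ModuleCat.comp_apply, ← complexBetti.map_comp, hsq,
    complexBetti.map_id, ModuleCat.id_apply]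
  exact cupProduct_cupPowTwo_mem_algebraicClasses hX hsζ (hx b) b (by have := b.2; omega) _

/-- `q_*(ζʳ) ≠ 0` read as `q_*(ζʳ) = λ · 1` with `λ ≠ 0` (`H⁰(X(ℂ); ℂ) = ℂ · 1`, `X(ℂ)` being path
connected for `X` smooth projective). [cite: HatcherAT2002, §3.1 p. 199] -/
theorem exists_complexGysin_cupPowTwo_eq_smul_one (μ : OrientationFamily) (hX : IsSmoothProjective n X)
    (hE : IsSmoothProjective (n + r) E) (q : E ⟶ X) (ζ : complexBetti E 2)
    (hne : complexGysin μ hE hX q (show 2 * r + 2 * n = 0 + 2 * (n + r) by ring) (cupPowTwo ζ r) ≠ 0) :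
    ∃ lam : ℂ, lam ≠ 0 ∧
      complexGysin μ hE hX q (show 2 * r + 2 * n = 0 + 2 * (n + r) by ring) (cupPowTwo ζ r) =
        lam • singularCohomology.one ℂ _ := by
  haveI := pathConnectedSpace_complexPoints hX
  obtain ⟨lam, hlam⟩ := singularCohomology.exists_eq_smul_one
    (complexGysin μ hE hX q (show 2 * r + 2 * n = 0 + 2 * (n + r) by ring) (cupPowTwo ζ r))
  refine ⟨lam, fun h0 ↦ hne ?_, hlam⟩
  rw [hlam, h0, zero_smul]

/-- **Pull-back of algebraic classes along a section of a fibration with a divisor-power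
expansion** — the registered stub `stub_sectionPullback` of `Cruxes/PullbackAlgebraic/Lines/normal_cone.lean`
with its Zariski-local triviality clause replaced by the three cohomological inputs it is used for:
(span) every class of `H²ᵖ(E(ℂ))` is `Σ_{b<B} q^* x_b ∪ ζᵇ` for a divisor class `ζ ∈ N¹ H²(E)`
(Leray–Hirsch), (coniv) `q^*` preserves algebraic classes (flatness), (λ) `q_*(ζʳ) ≠ 0` (fibre
degree). Then `s^*(Nᵖ H²ᵖ(E)) ⊆ Nᵖ H²ᵖ(X)` for every section `s` of `q`.
[cite: Fulton1998, Thm. 3.3 (b), §3.3 and Ex. 19.2.1] [cite: VoisinHodgeI2002, Lemma 7.32 and §7.3.3] -/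
theorem sectionPullback_of_lerayHirschSpan (μ : OrientationFamily) :
    ∀ ⦃n r : ℕ⦄ ⦃X E : SchemeOver ℂ⦄ (q : E ⟶ X) (s : X ⟶ E) (hX : IsSmoothProjective n X)
      (hE : IsSmoothProjective (n + r) E), s ≫ q = 𝟙 X →
      (∀ (c : ℕ), ∀ x ∈ algebraicClasses X c, complexBetti.map q (2 * c) x ∈ algebraicClasses E c) →
      (∃ ζ ∈ algebraicClasses E 1,
        complexGysin μ hE hX q (show 2 * r + 2 * n = 0 + 2 * (n + r) by ring) (cupPowTwo ζ r) ≠ 0 ∧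
        ∀ (p : ℕ) (y : complexBetti E (2 * p)), ∃ (B : ℕ) (hBp : B ≤ p + 1) (_ : B ≤ r + 1)
          (x : (b : Fin B) → complexBetti X (2 * (p - b))),
          y = ∑ b : Fin B, cupProduct (two_mul_sub_add p hBp b)
            (complexBetti.map q (2 * (p - b)) (x b)) (cupPowTwo ζ b)) →
      ∀ (p : ℕ), ∀ y ∈ algebraicClasses E p,
        complexBetti.map s (2 * p) y ∈ algebraicClasses X p := by
  intro n r X E q s hX hE hsq hconiv hζ p y hy
  obtain ⟨ζ, hζ1, hne, hspan⟩ := hζ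
  obtain ⟨lam, hlam0, hlam⟩ := exists_complexGysin_cupPowTwo_eq_smul_one μ hX hE q ζ hne
  obtain ⟨B, hBp, hBr, x, rfl⟩ := hspan p y
  exact map_section_sum_mem_algebraicClasses μ hX hE q s hsq hζ1 hconiv hlam0 hlam hBp hBr x hy

end Summit.HodgeConjecture.HodgeConjecture.Theorems

end
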